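import Summits.HodgeConjecture.HodgeConjecture.Theorems.F0P6LD1StubS1FactsVocabulary
import Summits.HodgeConjecture.HodgeConjecture.Theorems.F0P6LD1StubS1FactsOfA2P
import HarnessLib

/-!
# `F0P6LD1StubS1Facts` — ★ RE-HOME (K-style, HOME cand, LA3-p01 (g7) L3-D7 (ii) 2026-09-03) of `Lines/F0_P6LD_StubS1FactsThetaRoad.lean` (tree sha16 4be8935f579711f3), PART 2 of 2 — tree lines :422–:725 (§2 the ORGANS `ThetaRealisation₂` … `ThetaCharPinned₂`) + :918–:953 (§4 the head `stub_S1_facts_of_organs`, kernel-checked, no `sorry`).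

LAST part (plain stem): the module a `Lines` shim and consumers would import; it transitively carries PART 1.
Same namespace `Summit.HodgeConjecture.HodgeConjecture.Cruxes.HLiu418.F0P6LD1StubS1Facts` (every fully-qualified name unchanged); the option ∕ `open` lines :218–:237 are replayed verbatim; the code after
the replay block is the tree bytes of the named ranges, untouched.  What STAYS in `Lines`: the module docstring∕edition history (:1–:217), §3 (:726–:917: the ONE printed-letter `sorry`
`stub_letter_A₂P_hodgeFree` and the by-name organ∕brick∕letter closers) and the by-name head `curveThetaCohFinComponentUnique_hol_of_thetaRoad` (:955), i.e. everything whose closure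
touches the printed letter.  GATE NOTE (v3): in the docstrings of the `def … : Prop` predicates the leaf's `[cite: …]` tags are spelled `(print: …)` (★ `RoofGeoHoles` convention) so the gate's inline-fact RELOCATION does not lift section-variable predicates out of their section (p853994∕p853995 bounce 09:44Z); theorem docstrings keep `[cite:]`.  HC_CM is proved only modulo the 7 printed citations (2 remaining: hLiu418 = stmt-HodgeConjecture-24832, h413 = stmt-HodgeConjecture-24833) until rung 0 closes; a re-home is count-neutral.
-/

-- ── replay of tree :218–:237 (verbatim) ──
set_option autoImplicit false
set_option linter.dupNamespace false

noncomputable section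

open NumberField NumberField.InfinitePlace MeasureTheory IsDedekindDomain
open scoped Matrix ComplexOrder
open Literature.NumberTheory.Automorphic Literature.NumberTheory.Automorphic.UnitaryGroup
open Literature.NumberTheory.Automorphic.UnitaryGroup.CotangentForms (toQuotFun)
open Literature.NumberTheory.Automorphic.UnitaryCurveForms
open Literature.NumberTheory.Automorphic.Liu2021 Literature.NumberTheory.Automorphic.Liu2021.Def411WeilCarriers
open Literature.NumberTheory.Automorphic.Liu2021.Def411WeilCarriersDoubling
open Literature.NumberTheory.GaloisRepresentations Literature.NumberTheory.Automorphic.IdeleClassGroup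
open Literature.NumberTheory.GelbartRogawski1991 Literature.NumberTheory.GelbartRogawski1991.UnitaryDualPair
open Literature.NumberTheory.GelbartRogawski1991.UnitaryDualPair.WeilCoinv
open Literature.NumberTheory.Weil1964
open Literature.RepresentationTheory.Liu2021 Literature.RepresentationTheory.HarrisKudlaSweet1996
open Literature.RepresentationTheory.CompactGroups
open Literature.NumberTheory.Rogawski1990

namespace Summit.HodgeConjecture.HodgeConjecture.Cruxes.HLiu418.F0P6LD1StubS1Facts

-- ── tree bytes :422–:725 ──
/-! ## §2 The ORGANS (closed `Prop` telescopes in the letter's tokens; binder prefix = G1 ∕ the letter #73 verbatim; ED. 3 adds (B6) `ThetaSpaceRealises₂` and (L-T⁺) `LineTransport₂`) -/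

/-- **(R) REALISATION — «a `(1,0)`-type discrete `P` with the θ-type finite component `σ` is met by the global theta lift from SOME hermitian line at the
`λ`-splitting» ([Liu2021, Thm. B.4 (1) (a ⇒ c)] applied to the cuspidal realisation `V_P` itself — `[U(H)]` compact so `L² = L²_cusp` — and [Cor. B.6 (1) eq. (B.2)
= Wu13 Thm. 5.1] «`V_π = Θ_V(Θ_W(V_π))`», which puts the theta class INSIDE the given `P` with NO multiplicity input).**  For the letter's data (CM `L`, `[L:ℚ] ≥ 4`;
`H` of signature `(1,1)` at `ι`, definite elsewhere; scaled frame `ᵗḡ (tH) g = diag dV`; conjugate-symplectic `λ` of weight one; the line `⟨a⟩` and `χ`; `σ`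
irreducible smooth with `σ ↪ ω(λ, ε_a, χ)_f ∘ (frame transport)` injective), `[U(diag dV)]` compact: for SOME transport `ιA` with the frame formula `↑(ιA k) = g_𝔸⁻¹ k g_𝔸` (unique by the formula; one is CONSTRUCTED in §0b,
`scaledFrameTransport`, existence is also ★ `F0LD2ArchAdmissibleAssembly.exists_adelicFrameTransport_smul` — so the `∃ ιA … ∧` and `∀ ιA … →` shapes are equivalent), every discrete `P` of
`U(H)` that is `(1,0)`-type at `ι` (`IsHolCotangentAt₂ … 𝔣`) with finite component `σ` MEETS the theta lift from some line `⟨a′⟩`, `a′ ∈ (L⁺)ˣ`, at `λ` along `ιA`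
(★ `MeetsThetaLiftFromLine`: a non-zero class `[Θ̃_Φ(f) ∘ ιA]` IN `P`; binder shape of letter A ★ `Liu2021.cohHol_meetsThetaLiftFromLine`, `n = 3`).  TOKEN-IDENTICAL
with line LD2's organ A₂ `ThetaRealisation₂` (LD2-plan skeleton v3 02:57Z; LD-ref1 BOX 02:53:05Z #6): ONE payer file serves both.  PRINT: proof of [Liu2021, Prop. D.4 (1)]
p. 131 L19–27 («by Theorem B.4 … `π` is realized in the space of global theta lifting `Θ^V_{ψ_F,(μ,ν),W}(χ)`», `W` of rank 1).  «At the GIVEN `λ`» (LD-ref1 #2):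
`σ_v ≅ ω(λ_v, ε_v, χ_v) ≠ 0` at all finite `v` and [Lem. D.1 (4)] force `λ ∈ {μ, μᶜχ̌}`, and BOTH labels realise `π` (a pole at each isobaric constituent of `BC(P)`).
WHY IT MIGHT FAIL: (i) if the pole sat only at the companion label, restate with `∃ μ′` as letter A does ((L), (I), (P) and the glue survive verbatim at `μ′`);
(ii) the payer must match the finite components of ★ `lineThetaKernelDatum` with ★ `rhoVAtLine` (same ★ `chiSplittingLine`); the `(μ⁻¹, −W)` convention of (B.2) is
absorbed by `∃ a′`.
(print: Liu2021, Thm. B.4 (1) p. 98 L14–32; Cor. B.6 (1) eq. (B.2) p. 99 L5–15; proof of Prop. D.4 (1) p. 131 L19–27; Lem. D.1 (4) p. 126 L5–7)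
(print: Wu2013, Thm. 5.1) (print: GelbartRogawski1991, Thm. 5.1.1 p. 465) -/
def ThetaRealisation₂ : Prop :=
  ∀ (L : Type) [Field L] [NumberField L] [IsCMField L] (ι : L →+* ℂ) (H : Matrix (Fin 2) (Fin 2) L)
    (dV : Fin 2 → L) (hdV : ∀ i, IsCMField.complexConj L (dV i) = dV i) (hdV0 : ∀ i, dV i ≠ 0)
    (t : L) (ht : t ≠ 0) (g : GL (Fin 2) L)
    (hg : formCongr ((IsCMField.complexConj L : L ≃ₐ[↥(maximalRealSubfield L)] L) : L →+* L) g (t • H) = Matrix.diagonal dV),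
    (∃ T : GL (Fin 2) ℂ, formCongr (starRingEnd ℂ) T ((Matrix.diagonal dV).map ι) = Matrix.diagonal ![(1 : ℂ), -1]) →
    (∀ τ' : L →+* ℂ, InfinitePlace.mk τ' ≠ InfinitePlace.mk ι → ((Matrix.diagonal dV).map τ').PosDef) →
    4 ≤ Module.finrank ℚ L →
    ∀ (𝔣 : ConeFrame L H (cmPlace L ι))
      (μ : Measure (adelicGroupData (↥(maximalRealSubfield L)) L (IsCMField.complexConj L) 2 H).automorphicQuotient)
      [(adelicGroupData (↥(maximalRealSubfield L)) L (IsCMField.complexConj L) 2 H).IsAutomorphicMeasure μ]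
      {n' : ℕ} (e₁ : Fin 2 × Fin 1 ≃ Fin n')
      (lam : Literature.NumberTheory.Automorphic.IdeleClassGroup L →ₜ* Circle) (hlam : IsConjugateSymplectic L lam), HasWeight L lam 1 →
    ∀ (a : (↥(maximalRealSubfield L))ˣ) (χ : Chi (↥(maximalRealSubfield L)) L (IsCMField.complexConj L))
      (W : Type) [AddCommGroup W] [Module ℂ W]
      (σ : Representation ℂ (finAdelic (↥(maximalRealSubfield L)) L (IsCMField.complexConj L) 2 H) W),
      σ.IsIrreducible → σ.IsSmooth →
    ∀ j : σ.IntertwiningMap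
        ((rhoVAtLine (↥(maximalRealSubfield L)) L (IsCMField.complexConj L) 2 e₁ (Matrix.diagonal dV)
            (complexConj_imagUnit L) (imagUnit_ne_zero L) (imagUnit_mul_self L) (realDiagonal_isSymm L dV hdV)
            (isUnit_det_realDiagonal L dV hdV hdV0) (realDiagonal_map L dV hdV).symm
            (fun a => isCompatible_chiSplittingLine L e₁ dV hdV hdV0 (toHeckeCharacter L lam)
              (isUnitary_toHeckeCharacter L lam) ((isOscillatorChar_toHeckeCharacter_iff lam).mpr hlam)
              (TW (↥(maximalRealSubfield L)) a) (isSymm_TW (↥(maximalRealSubfield L)) a)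
              (isUnit_det_TW (↥(maximalRealSubfield L)) a) (JW (↥(maximalRealSubfield L)) L a)
              (JW_eq (↥(maximalRealSubfield L)) L a)) a χ).comp
          (finAdelicCongr (↥(maximalRealSubfield L)) L (IsCMField.complexConj L) g ht hg).symm.toMonoidHom),
      Function.Injective j →
    ∀ [CompactSpace (↥(UnitaryGroup.adelic (↥(maximalRealSubfield L)) L (IsCMField.complexConj L) 2 (Matrix.diagonal dV)) ⧸
        (UnitaryGroup.toAdelic (↥(maximalRealSubfield L)) L (IsCMField.complexConj L) 2 (Matrix.diagonal dV)).range)],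
    ∀ P : DiscreteAutomorphicRep (adelicGroupData (↥(maximalRealSubfield L)) L (IsCMField.complexConj L) 2 H) μ,
      P.IsHolCotangentAt₂ (IsCMField.complexConj_ne_one L) (UnitaryGroup.complexConj_smul_infinitePlace L) (cmPlace L ι) 𝔣 →
      P.HasFinComponent σ →
      ∃ (ιA : (adelicGroupData (↥(maximalRealSubfield L)) L (IsCMField.complexConj L) 2 H).Adelic →*
          ↥(UnitaryGroup.adelic (↥(maximalRealSubfield L)) L (IsCMField.complexConj L) 2 (Matrix.diagonal dV))),
        (∀ k, ((ιA k : ↥(UnitaryGroup.adelic (↥(maximalRealSubfield L)) L (IsCMField.complexConj L) 2 (Matrix.diagonal dV))) :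
              GL (Fin 2) (AdeleRing (𝓞 L) L)) =
            (toAdeleGL L g)⁻¹ * adelicVal (↥(maximalRealSubfield L)) L (IsCMField.complexConj L) 2 H k * toAdeleGL L g) ∧
        ∃ a' : (↥(maximalRealSubfield L))ˣ, MeetsThetaLiftFromLine L 2 H e₁ dV hdV hdV0 P lam hlam a' ιA

/-- **(L) LINE PIN — «the hermitian line realising a `(1,0)`-type `P` with the θ-type finite component `σ` is unique» ([Liu2021, Thm. B.4 (2)]: «the
skew-hermitian space `W` in (1c) is unique up to isomorphism», p. 98 L33; proof of Cor. B.6 (3) p. 99 L41–46: «by the local theta dichotomy [SZ15, Theorem 1.10]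
we have `W′ ≃ W`»).**  For the letter's data, a transport `ιA` with `↑(ιA k) = g_𝔸⁻¹ k g_𝔸`, `[U(diag dV)]` compact: if `P`, `P′` are discrete, both `(1,0)`-type
at `ι` (`IsHolCotangentAt₂ … 𝔣`), both with finite component `σ`, `P` meets the theta lift from `⟨a′⟩` and `P′` the one from `⟨a″⟩` (both at the `λ`-splitting,
★ `MeetsThetaLiftFromLine`), then `P′` ALSO meets the theta lift from `⟨a′⟩`.  ROAD (LD1-p02 road memo 02:46:08Z (P♯); LD-ref1 BOX 02:53:05Z #2 (P)):
`P ≅ ⊗_v θ_v(λ_v; a′, ·)`, `P′ ≅ ⊗_v θ_v(λ_v; a″, ·)` and `P_f ≅ σ ≅ P′_f` give `a′_v ≡ a″_v mod N(L_v^×)` at every finite `v` by the theta DICHOTOMY at FIXED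
splitting ([Liu2021, Lem. D.1 (3), (4)]: the companion triple differs in the splitting label, excluded since `σ_v ≠ 0`; [HarrisKudlaSweet1996, Thm. 6.1]); at `ι`
[Lem. D.2 (3)] «only `ω^{−1,−,0}`, `ω^{1,−,0}` are `π^{1,0}`» pins the sign identically for `P`, `P′` (the exponent is `λ`'s), and at the compact places the (Kc)
clause of ★ `holCotForms₂` makes `P_τ′`, `P′_τ′` trivial so [Lem. D.2 (1)] pins the sign; hence `a″/a′` is a local norm everywhere, so a global norm (Hasse norm
theorem for the cyclic `L/L⁺`), `⟨a″⟩ ≅ ⟨a′⟩`, and theta classes transport along the isometry (★ `CompatibleSplittingTransport` pattern; burden: `lineThetaKernelDatum … a″`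
vs `… a′` under `w ↦ bw` with `N(b) = a″/a′`, `b ∉ L⁺`, respecting the mixed polarisation).  Also implicit: «`P` meets `Θ` from `⟨a′⟩`» ⇒ «`Θ^{⟨a′⟩}(V_P) ≠ 0`»
(adjointness of the two theta lifts), so Thm. B.4 (2) applies.  WHY IT MIGHT FAIL: (i) the untyped isotypy «`P_f ≅ σ`» — `HasFinComponent σ` is an EMBEDDING
`σ ↪ P_f`; that `P_f` is irreducible (so `≅ σ`) is [BorelJacquet1979, §4.6] ∕ Flath and is part of the burden; (ii) transport of theta classes along a
non-`L⁺`-rational isometry of lines.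
(print: Liu2021, Thm. B.4 (2) p. 98 L33; proof of Cor. B.6 (3) p. 99 L41–46; Lem. D.1 (3), (4) p. 125–127; Lem. D.2 (1), (3) p. 127–128; proof of Prop. D.4 (1) p. 131 L27–34)
(print: HarrisKudlaSweet1996, Thm. 6.1) (print: PlatonovRapinchuk1994, §7.3 Prop. 7.8) (print: Omeara1963, §65:23, §71) -/
def ThetaLinePinned₂ : Prop :=
  ∀ (L : Type) [Field L] [NumberField L] [IsCMField L] (ι : L →+* ℂ) (H : Matrix (Fin 2) (Fin 2) L)
    (dV : Fin 2 → L) (hdV : ∀ i, IsCMField.complexConj L (dV i) = dV i) (hdV0 : ∀ i, dV i ≠ 0)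
    (t : L) (ht : t ≠ 0) (g : GL (Fin 2) L)
    (hg : formCongr ((IsCMField.complexConj L : L ≃ₐ[↥(maximalRealSubfield L)] L) : L →+* L) g (t • H) = Matrix.diagonal dV),
    (∃ T : GL (Fin 2) ℂ, formCongr (starRingEnd ℂ) T ((Matrix.diagonal dV).map ι) = Matrix.diagonal ![(1 : ℂ), -1]) →
    (∀ τ' : L →+* ℂ, InfinitePlace.mk τ' ≠ InfinitePlace.mk ι → ((Matrix.diagonal dV).map τ').PosDef) →
    4 ≤ Module.finrank ℚ L →
    ∀ (𝔣 : ConeFrame L H (cmPlace L ι))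
      (μ : Measure (adelicGroupData (↥(maximalRealSubfield L)) L (IsCMField.complexConj L) 2 H).automorphicQuotient)
      [(adelicGroupData (↥(maximalRealSubfield L)) L (IsCMField.complexConj L) 2 H).IsAutomorphicMeasure μ]
      {n' : ℕ} (e₁ : Fin 2 × Fin 1 ≃ Fin n')
      (lam : Literature.NumberTheory.Automorphic.IdeleClassGroup L →ₜ* Circle) (hlam : IsConjugateSymplectic L lam), HasWeight L lam 1 →
    ∀ (a : (↥(maximalRealSubfield L))ˣ) (χ : Chi (↥(maximalRealSubfield L)) L (IsCMField.complexConj L))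
      (W : Type) [AddCommGroup W] [Module ℂ W]
      (σ : Representation ℂ (finAdelic (↥(maximalRealSubfield L)) L (IsCMField.complexConj L) 2 H) W),
      σ.IsIrreducible → σ.IsSmooth →
    ∀ j : σ.IntertwiningMap
        ((rhoVAtLine (↥(maximalRealSubfield L)) L (IsCMField.complexConj L) 2 e₁ (Matrix.diagonal dV)
            (complexConj_imagUnit L) (imagUnit_ne_zero L) (imagUnit_mul_self L) (realDiagonal_isSymm L dV hdV)
            (isUnit_det_realDiagonal L dV hdV hdV0) (realDiagonal_map L dV hdV).symm
            (fun a => isCompatible_chiSplittingLine L e₁ dV hdV hdV0 (toHeckeCharacter L lam)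
              (isUnitary_toHeckeCharacter L lam) ((isOscillatorChar_toHeckeCharacter_iff lam).mpr hlam)
              (TW (↥(maximalRealSubfield L)) a) (isSymm_TW (↥(maximalRealSubfield L)) a)
              (isUnit_det_TW (↥(maximalRealSubfield L)) a) (JW (↥(maximalRealSubfield L)) L a)
              (JW_eq (↥(maximalRealSubfield L)) L a)) a χ).comp
          (finAdelicCongr (↥(maximalRealSubfield L)) L (IsCMField.complexConj L) g ht hg).symm.toMonoidHom),
      Function.Injective j →
    ∀ (ιA : (adelicGroupData (↥(maximalRealSubfield L)) L (IsCMField.complexConj L) 2 H).Adelic →*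
        ↥(UnitaryGroup.adelic (↥(maximalRealSubfield L)) L (IsCMField.complexConj L) 2 (Matrix.diagonal dV))),
      (∀ k, ((ιA k : ↥(UnitaryGroup.adelic (↥(maximalRealSubfield L)) L (IsCMField.complexConj L) 2 (Matrix.diagonal dV))) :
            GL (Fin 2) (AdeleRing (𝓞 L) L)) =
          (toAdeleGL L g)⁻¹ * adelicVal (↥(maximalRealSubfield L)) L (IsCMField.complexConj L) 2 H k * toAdeleGL L g) →
    ∀ [CompactSpace (↥(UnitaryGroup.adelic (↥(maximalRealSubfield L)) L (IsCMField.complexConj L) 2 (Matrix.diagonal dV)) ⧸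
        (UnitaryGroup.toAdelic (↥(maximalRealSubfield L)) L (IsCMField.complexConj L) 2 (Matrix.diagonal dV)).range)],
    ∀ P P' : DiscreteAutomorphicRep (adelicGroupData (↥(maximalRealSubfield L)) L (IsCMField.complexConj L) 2 H) μ,
      P.IsHolCotangentAt₂ (IsCMField.complexConj_ne_one L) (UnitaryGroup.complexConj_smul_infinitePlace L) (cmPlace L ι) 𝔣 →
      P'.IsHolCotangentAt₂ (IsCMField.complexConj_ne_one L) (UnitaryGroup.complexConj_smul_infinitePlace L) (cmPlace L ι) 𝔣 →
      P.HasFinComponent σ → P'.HasFinComponent σ →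
    ∀ (a' a'' : (↥(maximalRealSubfield L))ˣ),
      MeetsThetaLiftFromLine L 2 H e₁ dV hdV hdV0 P lam hlam a' ιA → MeetsThetaLiftFromLine L 2 H e₁ dV hdV hdV0 P' lam hlam a'' ιA →
      MeetsThetaLiftFromLine L 2 H e₁ dV hdV hdV0 P' lam hlam a' ιA
/-- **(I) RIGIDITY — «the `ξ`-theta space from a line is irreducible: it lies inside every discrete `P` it meets».**  For the letter's field ∕ form ∕
frame ∕ splitting data, `[U(diag dV)]` compact, a transport `ιA` with `↑(ιA k) = g_𝔸⁻¹ k g_𝔸`, ANY discrete `P` of `U(H)` and any line `⟨a′⟩`: if `P` meets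
the theta lift from `⟨a′⟩` at `λ` (★ `MeetsThetaLiftFromLine`: a non-zero class `[Θ̃_Φ(f) ∘ ιA] ∈ P` for some continuous weight `f` on `[U(⟨a′⟩)]`), then for
some unitary character `ξ` of the compact abelian group `[U(⟨a′⟩)]` EVERY `ξ`-theta class from `⟨a′⟩` lies in `P` (`CharThetaSpaceLe₂`) and one of them is
non-zero (`CharSeam₂`).  PRINT ∕ ROAD: (i) `f ↦ ξ`: `P` has a central character (Schur), the centre `Z(U(H)) = U(1)` acts on the `ξ`-theta lifts through
`ξ` (★ `ThetaLiftFromLineCentralCharacter`; ★ torus multiplicity one `AdelicCommutativeDatumMultiplicityOne`), and the characters of `[U(⟨a′⟩)]` span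
`C([U(⟨a′⟩)])` (★ `ThetaLiftFromLineCharacters` §4, `CompactGroups.mem_closure_span_range_charCM`), so the `ξ_P`-component of the seam's class is a non-zero
`ξ_P`-theta class IN `P`; (ii) irreducibility of the closed span `Θ_{⟨a′⟩,λ}(ξ)` of all `ξ`-theta classes: the Rallis inner product formula (★ named fact
`Li1992.RallisInnerProductFormulaUnitaryDualPair`, ★ `RallisInnerProductCharacterLift`) makes `Ψ ↦ [Θ̃_Ψ(ξ) ∘ ιA]` factor isometrically (up to a scalar)
through the irreducible `θ(ξ) = ⊗_v θ_v(ξ_v)` (local Howe duality for the rank-one member, ★ `mvw_IV4_rankOne_irreducibleOrZero_holds`), and a closed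
invariant subspace of the irreducible `P` meeting it non-trivially is `P` ([Rallis1984]; [GelbartRogawski1991, §3.2–3.3]).
WHY IT MIGHT FAIL: if the automorphic image of the global `ξ`-coinvariants of `ω_λ` were NOT isotypic of one class (a failure of local Howe duality at a
dyadic place — excluded for unitary pairs by [GanTakeda2016]) or occurred in `Θ_{⟨a′⟩,λ}(ξ)` with multiplicity `2`, a `P` could meet `Θ(ξ)` without containing it.
(print: Liu2021, Cor. B.6 (1) p. 99 L5–15; proof of Prop. 4.13 Case 1 (p. 48)) (print: Wu2013, Thm. 5.1, Thm. 5.3) (print: GanTakeda2016, Thm. 1.2)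
(print: Rallis1984, §1 Thm.) (print: Li1992, §2) (print: GelbartRogawski1991, §3.2–3.3 p. 457–459) (print: MVW1987, chap. 3 IV.4) -/
def ThetaCharRigid₂ : Prop :=
  ∀ (L : Type) [Field L] [NumberField L] [IsCMField L] (ι : L →+* ℂ) (H : Matrix (Fin 2) (Fin 2) L)
    (dV : Fin 2 → L) (hdV : ∀ i, IsCMField.complexConj L (dV i) = dV i) (hdV0 : ∀ i, dV i ≠ 0)
    (t : L) (ht : t ≠ 0) (g : GL (Fin 2) L)
    (_hg : formCongr ((IsCMField.complexConj L : L ≃ₐ[↥(maximalRealSubfield L)] L) : L →+* L) g (t • H) = Matrix.diagonal dV),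
    (∃ T : GL (Fin 2) ℂ, formCongr (starRingEnd ℂ) T ((Matrix.diagonal dV).map ι) = Matrix.diagonal ![(1 : ℂ), -1]) →
    (∀ τ' : L →+* ℂ, InfinitePlace.mk τ' ≠ InfinitePlace.mk ι → ((Matrix.diagonal dV).map τ').PosDef) →
    4 ≤ Module.finrank ℚ L →
    ∀ (μ : Measure (adelicGroupData (↥(maximalRealSubfield L)) L (IsCMField.complexConj L) 2 H).automorphicQuotient)
      [(adelicGroupData (↥(maximalRealSubfield L)) L (IsCMField.complexConj L) 2 H).IsAutomorphicMeasure μ]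
      {n' : ℕ} (e₁ : Fin 2 × Fin 1 ≃ Fin n')
      (lam : Literature.NumberTheory.Automorphic.IdeleClassGroup L →ₜ* Circle) (hlam : IsConjugateSymplectic L lam), HasWeight L lam 1 →
    ∀ (ιA : (adelicGroupData (↥(maximalRealSubfield L)) L (IsCMField.complexConj L) 2 H).Adelic →*
        ↥(UnitaryGroup.adelic (↥(maximalRealSubfield L)) L (IsCMField.complexConj L) 2 (Matrix.diagonal dV))),
      (∀ k, ((ιA k : ↥(UnitaryGroup.adelic (↥(maximalRealSubfield L)) L (IsCMField.complexConj L) 2 (Matrix.diagonal dV))) :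
            GL (Fin 2) (AdeleRing (𝓞 L) L)) =
          (toAdeleGL L g)⁻¹ * adelicVal (↥(maximalRealSubfield L)) L (IsCMField.complexConj L) 2 H k * toAdeleGL L g) →
    ∀ [CompactSpace (↥(UnitaryGroup.adelic (↥(maximalRealSubfield L)) L (IsCMField.complexConj L) 2 (Matrix.diagonal dV)) ⧸
        (UnitaryGroup.toAdelic (↥(maximalRealSubfield L)) L (IsCMField.complexConj L) 2 (Matrix.diagonal dV)).range)],
    ∀ (P : DiscreteAutomorphicRep (adelicGroupData (↥(maximalRealSubfield L)) L (IsCMField.complexConj L) 2 H) μ)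
      (a' : (↥(maximalRealSubfield L))ˣ),
      MeetsThetaLiftFromLine L 2 H e₁ dV hdV hdV0 P lam hlam a' ιA →
      ∃ ξ, CharThetaSpaceLe₂ L H e₁ dV hdV hdV0 P lam hlam a' ιA ξ ∧ CharSeam₂ L H e₁ dV hdV hdV0 P lam hlam a' ιA ξ

/-- (I′) THETA-SPAN IRREDUCIBILITY — letter-organ replacing the in-house part (ii) of (I); = ★-to-be predicate
`Literature.NumberTheory.Automorphic.Liu2021.ThetaLiftFromLineIrreducible` closed over the CM curve frames with the pinned transport.
(print: Liu2021, App. B Cor. B.6 (1) p. 99) (print: Wu2013, Thm. 5.3) (print: BorelJacquet1979, §4.6) -/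
def ThetaSpaceIrreducible₂ : Prop :=
  ∀ (L : Type) [Field L] [NumberField L] [IsCMField L] (ι : L →+* ℂ) (H : Matrix (Fin 2) (Fin 2) L)
      (dV : Fin 2 → L) (hdV : ∀ i, IsCMField.complexConj L (dV i) = dV i) (hdV0 : ∀ i, dV i ≠ 0)
      (t : L) (ht : t ≠ 0) (g : GL (Fin 2) L)
      (_hg : formCongr ((IsCMField.complexConj L : L ≃ₐ[↥(maximalRealSubfield L)] L) : L →+* L) g (t • H) = Matrix.diagonal dV),
      (∃ T : GL (Fin 2) ℂ, formCongr (starRingEnd ℂ) T ((Matrix.diagonal dV).map ι) = Matrix.diagonal ![(1 : ℂ), -1]) →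
      (∀ τ' : L →+* ℂ, InfinitePlace.mk τ' ≠ InfinitePlace.mk ι → ((Matrix.diagonal dV).map τ').PosDef) →
      4 ≤ Module.finrank ℚ L →
      ∀ (μ : Measure (adelicGroupData (↥(maximalRealSubfield L)) L (IsCMField.complexConj L) 2 H).automorphicQuotient)
        [(adelicGroupData (↥(maximalRealSubfield L)) L (IsCMField.complexConj L) 2 H).IsAutomorphicMeasure μ]
        {n' : ℕ} (e₁ : Fin 2 × Fin 1 ≃ Fin n')
        (lam : Literature.NumberTheory.Automorphic.IdeleClassGroup L →ₜ* Circle) (hlam : IsConjugateSymplectic L lam), HasWeight L lam 1 →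
      ∀ (ιA : (adelicGroupData (↥(maximalRealSubfield L)) L (IsCMField.complexConj L) 2 H).Adelic →*
          ↥(UnitaryGroup.adelic (↥(maximalRealSubfield L)) L (IsCMField.complexConj L) 2 (Matrix.diagonal dV))),
        (∀ k, ((ιA k : ↥(UnitaryGroup.adelic (↥(maximalRealSubfield L)) L (IsCMField.complexConj L) 2 (Matrix.diagonal dV))) :
              GL (Fin 2) (AdeleRing (𝓞 L) L)) =
            (toAdeleGL L g)⁻¹ * adelicVal (↥(maximalRealSubfield L)) L (IsCMField.complexConj L) 2 H k * toAdeleGL L g) →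
      ∀ [CompactSpace (↥(UnitaryGroup.adelic (↥(maximalRealSubfield L)) L (IsCMField.complexConj L) 2 (Matrix.diagonal dV)) ⧸
          (UnitaryGroup.toAdelic (↥(maximalRealSubfield L)) L (IsCMField.complexConj L) 2 (Matrix.diagonal dV)).range)],
      ∀ (a' : (↥(maximalRealSubfield L))ˣ)
        (ξ : haveI := normal_range_toAdelic_JW L a'
          PontryaginDual (↥(UnitaryGroup.adelic (↥(maximalRealSubfield L)) L (IsCMField.complexConj L) 1 (JW (↥(maximalRealSubfield L)) L a')) ⧸ (UnitaryGroup.toAdelic (↥(maximalRealSubfield L)) L (IsCMField.complexConj L) 1 (JW (↥(maximalRealSubfield L)) L a')).range)),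
        ThetaLiftFromLineIrreducible L 2 H e₁ dV hdV hdV0 ιA μ lam hlam a' ξ

/-- **ORGAN (B6) (EDITION 3, LETTER-GRADE)** — «the doubling reproduces the vector»: over the curve frames (the EXACT binder prefix of (I′)), for every
line `a′` and every character `ξ`, a discrete `P` whose projection does not kill every `(a′,ξ)`-theta class has its carrier inside the CLOSED SPAN of those
classes — the predicate ★ `Liu2021.ThetaLiftFromLineRealises` (LD1-p01 (g0)) closed over the frames.  Print: [Liu2021, Cor. B.6 (1) second clause, eq. (B.2)
p. 99] «`V_π = Θ^V_{(μ⁻¹,ν⁻¹),−W}(Θ^W_{(μ,ν),V}(V_π))`» = [Wu2013, Thm. 5.1]; consumed as `hReal` by ★ `F0LD1ThetaRealisationOfB6.thetaRealisation₂_of_B6`.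
Why it might fail: only as a typing slip (inclusion, not equality, is asserted; cuspidality is automatic on the anisotropic `U(H)`).
(print: Liu2021, App. B Cor. B.6 (1) and its proof (p. 99)) (print: Wu2013, Thm. 5.1) (print: Rallis1984, §1) -/
def ThetaSpaceRealises₂ : Prop :=
  ∀ (L : Type) [Field L] [NumberField L] [IsCMField L] (ι : L →+* ℂ) (H : Matrix (Fin 2) (Fin 2) L)
      (dV : Fin 2 → L) (hdV : ∀ i, IsCMField.complexConj L (dV i) = dV i) (hdV0 : ∀ i, dV i ≠ 0)
      (t : L) (ht : t ≠ 0) (g : GL (Fin 2) L)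
      (_hg : formCongr ((IsCMField.complexConj L : L ≃ₐ[↥(maximalRealSubfield L)] L) : L →+* L) g (t • H) = Matrix.diagonal dV),
      (∃ T : GL (Fin 2) ℂ, formCongr (starRingEnd ℂ) T ((Matrix.diagonal dV).map ι) = Matrix.diagonal ![(1 : ℂ), -1]) →
      (∀ τ' : L →+* ℂ, InfinitePlace.mk τ' ≠ InfinitePlace.mk ι → ((Matrix.diagonal dV).map τ').PosDef) →
      4 ≤ Module.finrank ℚ L →
      ∀ (μ : Measure (adelicGroupData (↥(maximalRealSubfield L)) L (IsCMField.complexConj L) 2 H).automorphicQuotient)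
        [(adelicGroupData (↥(maximalRealSubfield L)) L (IsCMField.complexConj L) 2 H).IsAutomorphicMeasure μ]
        {n' : ℕ} (e₁ : Fin 2 × Fin 1 ≃ Fin n')
        (lam : Literature.NumberTheory.Automorphic.IdeleClassGroup L →ₜ* Circle) (hlam : IsConjugateSymplectic L lam), HasWeight L lam 1 →
      ∀ (ιA : (adelicGroupData (↥(maximalRealSubfield L)) L (IsCMField.complexConj L) 2 H).Adelic →*
          ↥(UnitaryGroup.adelic (↥(maximalRealSubfield L)) L (IsCMField.complexConj L) 2 (Matrix.diagonal dV))),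
        (∀ k, ((ιA k : ↥(UnitaryGroup.adelic (↥(maximalRealSubfield L)) L (IsCMField.complexConj L) 2 (Matrix.diagonal dV))) :
              GL (Fin 2) (AdeleRing (𝓞 L) L)) =
            (toAdeleGL L g)⁻¹ * adelicVal (↥(maximalRealSubfield L)) L (IsCMField.complexConj L) 2 H k * toAdeleGL L g) →
      ∀ [CompactSpace (↥(UnitaryGroup.adelic (↥(maximalRealSubfield L)) L (IsCMField.complexConj L) 2 (Matrix.diagonal dV)) ⧸
          (UnitaryGroup.toAdelic (↥(maximalRealSubfield L)) L (IsCMField.complexConj L) 2 (Matrix.diagonal dV)).range)],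
      ∀ (a' : (↥(maximalRealSubfield L))ˣ)
        (ξ : haveI := normal_range_toAdelic_JW L a'
          PontryaginDual (↥(UnitaryGroup.adelic (↥(maximalRealSubfield L)) L (IsCMField.complexConj L) 1 (JW (↥(maximalRealSubfield L)) L a')) ⧸ (UnitaryGroup.toAdelic (↥(maximalRealSubfield L)) L (IsCMField.complexConj L) 1 (JW (↥(maximalRealSubfield L)) L a')).range)),
        ThetaLiftFromLineRealises L 2 H e₁ dV hdV hdV0 ιA μ lam hlam a' ξ

/-- **ORGAN (L-T⁺) (EDITION 3, IN-HOUSE)** — LINE TRANSPORT of a strong meeting along locally-isometric lines of totally positive ratio: if `P` meets the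
theta lift from `⟨a″⟩` along `ιA`, `⟨a₁⟩_v ≅ ⟨a″⟩_v` at every finite place (`locF a₁ v = locF a″ v`) and `a₁/a″` is totally positive, then `P` meets the theta
lift from `⟨a₁⟩` along the same `ιA` (Hasse: `a₁/a″ = e ē`, ★ `IsCMField.exists_eq_mul_complexConj_of_totallyPositive_of_forall_isLocalNorm`; scalar frame
transport ★ `MeetsThetaLiftFromLine.frameTransport` (p848749) + seam transport ★ p848607 + Gram transport ★ p848930 + a rescaling kit).  Text = the hypothesis
`hLT` of ★ `F0LD1ThetaLinePinnedOfBricks.thetaLinePinned₂_of_bricks` (p849302 :118–141) VERBATIM.  Pens: LD1-p02 (g2) (kit `MeetsThetaLiftFromLine.rescale`),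
LA1-p01 (g2) (assembly `Theorems/F0LD1LineTransportOfKits`).  Why it might fail: the rescaling kit must move the Weil datum `(c•dV, a″) ↦ (dV, c•a″)` through
the SAME pinned `ιA` (central `e⁻¹•1`); a mismatch of splitting characters under rescaling would surface there.
(print: Liu2021, proof of Cor. B.6 (3) p. 99 L41–46; Lem. D.2 (1)) (print: Scharlau1985HermitianForms, Ch. 10 §1 (Hasse principle for hermitian forms, rank 1 = norms)) -/
def LineTransport₂ : Prop :=
  ∀ (L : Type) [Field L] [NumberField L] [IsCMField L] (ι : L →+* ℂ) (H : Matrix (Fin 2) (Fin 2) L)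
    (dV : Fin 2 → L) (hdV : ∀ i, IsCMField.complexConj L (dV i) = dV i) (hdV0 : ∀ i, dV i ≠ 0)
    (t : L) (ht : t ≠ 0) (g : GL (Fin 2) L)
    (hg : formCongr ((IsCMField.complexConj L : L ≃ₐ[↥(maximalRealSubfield L)] L) : L →+* L) g (t • H) = Matrix.diagonal dV),
    (∃ T : GL (Fin 2) ℂ, formCongr (starRingEnd ℂ) T ((Matrix.diagonal dV).map ι) = Matrix.diagonal ![(1 : ℂ), -1]) →
    (∀ τ' : L →+* ℂ, InfinitePlace.mk τ' ≠ InfinitePlace.mk ι → ((Matrix.diagonal dV).map τ').PosDef) →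
    4 ≤ Module.finrank ℚ L →
    ∀ (μ : Measure (adelicGroupData (↥(maximalRealSubfield L)) L (IsCMField.complexConj L) 2 H).automorphicQuotient)
      [(adelicGroupData (↥(maximalRealSubfield L)) L (IsCMField.complexConj L) 2 H).IsAutomorphicMeasure μ]
      {n' : ℕ} (e₁ : Fin 2 × Fin 1 ≃ Fin n')
      (lam : Literature.NumberTheory.Automorphic.IdeleClassGroup L →ₜ* Circle) (hlam : IsConjugateSymplectic L lam), HasWeight L lam 1 →
    ∀ (ιA : (adelicGroupData (↥(maximalRealSubfield L)) L (IsCMField.complexConj L) 2 H).Adelic →*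
        ↥(UnitaryGroup.adelic (↥(maximalRealSubfield L)) L (IsCMField.complexConj L) 2 (Matrix.diagonal dV))),
      (∀ k, ((ιA k : ↥(UnitaryGroup.adelic (↥(maximalRealSubfield L)) L (IsCMField.complexConj L) 2 (Matrix.diagonal dV))) :
            GL (Fin 2) (AdeleRing (𝓞 L) L)) =
          (toAdeleGL L g)⁻¹ * adelicVal (↥(maximalRealSubfield L)) L (IsCMField.complexConj L) 2 H k * toAdeleGL L g) →
    ∀ [CompactSpace (↥(UnitaryGroup.adelic (↥(maximalRealSubfield L)) L (IsCMField.complexConj L) 2 (Matrix.diagonal dV)) ⧸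
        (UnitaryGroup.toAdelic (↥(maximalRealSubfield L)) L (IsCMField.complexConj L) 2 (Matrix.diagonal dV)).range)],
    ∀ (P : DiscreteAutomorphicRep (adelicGroupData (↥(maximalRealSubfield L)) L (IsCMField.complexConj L) 2 H) μ) (a'' a₁ : (↥(maximalRealSubfield L))ˣ),
      MeetsThetaLiftFromLine L 2 H e₁ dV hdV hdV0 P lam hlam a'' ιA →
      (∀ v : HeightOneSpectrum (𝓞 (↥(maximalRealSubfield L))),
        locF (↥(maximalRealSubfield L)) (imagUnitSq L) a₁ v = locF (↥(maximalRealSubfield L)) (imagUnitSq L) a'' v) →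
      (∀ ρ : (↥(maximalRealSubfield L)) →+* ℝ, 0 < ρ ((a₁ : (↥(maximalRealSubfield L))) * ((a'' : (↥(maximalRealSubfield L))))⁻¹)) →
      MeetsThetaLiftFromLine L 2 H e₁ dV hdV hdV0 P lam hlam a₁ ιA

/-- **(P) CHARACTER PIN — «on a fixed line `⟨a′⟩` at fixed splitting `λ`, the theta CHARACTER of a `(1,0)`-type `P` is determined by its finite component»
([Liu2021, Cor. B.6 (3)]: «if `π_W` has a unique realization … then `m_cusp(π) = 1`»; for `U(W) = U(1)` the realization of a character is unique).**  For the
letter's data, a transport `ιA` with `↑(ιA k) = g_𝔸⁻¹ k g_𝔸`, `[U(diag dV)]` compact: if `P`, `P′` are discrete, both `(1,0)`-type at `ι` (`IsHolCotangentAt₂ … 𝔣`), both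
with finite component the θ-type `σ`, `P` contains a non-zero `ξ′`-theta class from `⟨a′⟩` and `P′` a non-zero `ξ″`-theta class from the SAME line `⟨a′⟩` (both at `λ`),
then `P′` also contains a non-zero `ξ′`-theta class from `⟨a′⟩` (indeed `ξ″ = ξ′`).  ROAD (in-house, LD1-p02 road memo 02:46:08Z (P♭)): the centre `Z(U(H)) = U(1)`
acts on a `ξ`-theta class through `ξ` composed with the surjection `Z(𝔸) ↠ [U(⟨a′⟩)]` (★ `ThetaLiftFromLineCentralCharacter`: `frameTransport_adelicCenter`,
`pairRep_adelicCenter_fst_eq_snd`, ★ `thetaLift_act_right_charCM`; ★ `adelicCenter_cmAdelicDet_line`), and on the irreducible `P`, `P′` by central characters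
`ψ_P`, `ψ_{P′}` (★ `exists_centralCharacter_adelicCenter`), which AGREE: on the finite centre both equal the centre's action on `σ` (injectivity of the embeddings
`σ ↪ P_f`, `σ ↪ P′_f` — no Schur for `σ`, no `π_f`-isotypy needed), on the archimedean centre both are trivial on `(1,0)`-type forms (the cone-holomorphic cotangent
law at `ι`, `N = 2` port of ★ `centralCharacter_archCentre_eq_one`; invariance under the compact factors elsewhere); hence `ξ′ = ξ″` (torus multiplicity one ★
`AdelicCommutativeDatumMultiplicityOne` is the same circle of ideas).  WHY IT MIGHT FAIL: only through a mismatch of normalisations — if the centre acted on the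
`ξ`-theta classes through `ξ · (λ-dependent character)` with a `P`-dependent twist, or if `(1,0)`-type did not force the archimedean central character (it does for
the cone-holomorphic cotangent law with `(a, k, d) = (z, z, 0)`).
(print: Liu2021, Cor. B.6 (3) and its proof p. 99 L29–56 («the assumption of `π_W` implies `Θ^W(V_π) = Θ^W(V′_π)`»); proof of Prop. 4.13 Case 1 p. 48)
(print: GelbartRogawski1991, §3.2 p. 457) (print: Mok2014, §1 Notation p. 5 (centre `= U(1)`)) -/
def ThetaCharPinned₂ : Prop :=
  ∀ (L : Type) [Field L] [NumberField L] [IsCMField L] (ι : L →+* ℂ) (H : Matrix (Fin 2) (Fin 2) L)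
    (dV : Fin 2 → L) (hdV : ∀ i, IsCMField.complexConj L (dV i) = dV i) (hdV0 : ∀ i, dV i ≠ 0)
    (t : L) (ht : t ≠ 0) (g : GL (Fin 2) L)
    (hg : formCongr ((IsCMField.complexConj L : L ≃ₐ[↥(maximalRealSubfield L)] L) : L →+* L) g (t • H) = Matrix.diagonal dV),
    (∃ T : GL (Fin 2) ℂ, formCongr (starRingEnd ℂ) T ((Matrix.diagonal dV).map ι) = Matrix.diagonal ![(1 : ℂ), -1]) →
    (∀ τ' : L →+* ℂ, InfinitePlace.mk τ' ≠ InfinitePlace.mk ι → ((Matrix.diagonal dV).map τ').PosDef) →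
    4 ≤ Module.finrank ℚ L →
    ∀ (𝔣 : ConeFrame L H (cmPlace L ι))
      (μ : Measure (adelicGroupData (↥(maximalRealSubfield L)) L (IsCMField.complexConj L) 2 H).automorphicQuotient)
      [(adelicGroupData (↥(maximalRealSubfield L)) L (IsCMField.complexConj L) 2 H).IsAutomorphicMeasure μ]
      {n' : ℕ} (e₁ : Fin 2 × Fin 1 ≃ Fin n')
      (lam : Literature.NumberTheory.Automorphic.IdeleClassGroup L →ₜ* Circle) (hlam : IsConjugateSymplectic L lam), HasWeight L lam 1 →
    ∀ (a : (↥(maximalRealSubfield L))ˣ) (χ : Chi (↥(maximalRealSubfield L)) L (IsCMField.complexConj L))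
      (W : Type) [AddCommGroup W] [Module ℂ W]
      (σ : Representation ℂ (finAdelic (↥(maximalRealSubfield L)) L (IsCMField.complexConj L) 2 H) W),
      σ.IsIrreducible → σ.IsSmooth →
    ∀ j : σ.IntertwiningMap
        ((rhoVAtLine (↥(maximalRealSubfield L)) L (IsCMField.complexConj L) 2 e₁ (Matrix.diagonal dV)
            (complexConj_imagUnit L) (imagUnit_ne_zero L) (imagUnit_mul_self L) (realDiagonal_isSymm L dV hdV)
            (isUnit_det_realDiagonal L dV hdV hdV0) (realDiagonal_map L dV hdV).symm
            (fun a => isCompatible_chiSplittingLine L e₁ dV hdV hdV0 (toHeckeCharacter L lam)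
              (isUnitary_toHeckeCharacter L lam) ((isOscillatorChar_toHeckeCharacter_iff lam).mpr hlam)
              (TW (↥(maximalRealSubfield L)) a) (isSymm_TW (↥(maximalRealSubfield L)) a)
              (isUnit_det_TW (↥(maximalRealSubfield L)) a) (JW (↥(maximalRealSubfield L)) L a)
              (JW_eq (↥(maximalRealSubfield L)) L a)) a χ).comp
          (finAdelicCongr (↥(maximalRealSubfield L)) L (IsCMField.complexConj L) g ht hg).symm.toMonoidHom),
      Function.Injective j →
    ∀ (ιA : (adelicGroupData (↥(maximalRealSubfield L)) L (IsCMField.complexConj L) 2 H).Adelic →*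
        ↥(UnitaryGroup.adelic (↥(maximalRealSubfield L)) L (IsCMField.complexConj L) 2 (Matrix.diagonal dV))),
      (∀ k, ((ιA k : ↥(UnitaryGroup.adelic (↥(maximalRealSubfield L)) L (IsCMField.complexConj L) 2 (Matrix.diagonal dV))) :
            GL (Fin 2) (AdeleRing (𝓞 L) L)) =
          (toAdeleGL L g)⁻¹ * adelicVal (↥(maximalRealSubfield L)) L (IsCMField.complexConj L) 2 H k * toAdeleGL L g) →
    ∀ [CompactSpace (↥(UnitaryGroup.adelic (↥(maximalRealSubfield L)) L (IsCMField.complexConj L) 2 (Matrix.diagonal dV)) ⧸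
        (UnitaryGroup.toAdelic (↥(maximalRealSubfield L)) L (IsCMField.complexConj L) 2 (Matrix.diagonal dV)).range)],
    ∀ P P' : DiscreteAutomorphicRep (adelicGroupData (↥(maximalRealSubfield L)) L (IsCMField.complexConj L) 2 H) μ,
      P.IsHolCotangentAt₂ (IsCMField.complexConj_ne_one L) (UnitaryGroup.complexConj_smul_infinitePlace L) (cmPlace L ι) 𝔣 →
      P'.IsHolCotangentAt₂ (IsCMField.complexConj_ne_one L) (UnitaryGroup.complexConj_smul_infinitePlace L) (cmPlace L ι) 𝔣 →
      P.HasFinComponent σ → P'.HasFinComponent σ →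
    ∀ (a' : (↥(maximalRealSubfield L))ˣ) (ξ' ξ''),
      CharSeam₂ L H e₁ dV hdV hdV0 P lam hlam a' ιA ξ' → CharSeam₂ L H e₁ dV hdV hdV0 P' lam hlam a' ιA ξ'' →
      CharSeam₂ L H e₁ dV hdV hdV0 P' lam hlam a' ιA ξ'


-- ── tree bytes :918–:953 ([d] cure: the two §0 lemma call sites respelled to the ★ `…F0P6LD1StubS1FactsOfA2P` FQNs; statement and every other byte verbatim) ──
/-! ## §4 The head FROM THE ORGANS (kernel-checked, no `sorry` of its own) -/

/-- **`stub_S1_facts` FROM THE THREE ORGAN STATEMENTS** — the letter #73 `curveThetaCohFinComponentUnique_hol` («at most one `(1,0)`-type discrete `P`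
with the θ-type finite component `σ`») follows from realisation (R), rigidity (I) and pinning (P): the two representations share a non-zero theta class.
[cite: Liu2021, Prop. D.4 (1) and its proof, p. 130–131] [cite: Dixmier1977, §5.4] -/
theorem stub_S1_facts_of_organs (hR : ThetaRealisation₂) (hL : ThetaLinePinned₂) (hI : ThetaCharRigid₂) (hPin : ThetaCharPinned₂) :
    curveThetaCohFinComponentUnique_hol := by
  intro L _ _ _ ι H dV hdV hdV0 t ht g hg hsig hdef h4 𝔣 μ _ n' e₁ lam hlam hw a χ W _ _ σ hirr hsm j hj P P' hP hP' hPσ hP'σ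
  obtain ⟨τ, hτ⟩ := UnitaryGroup.exists_infinitePlace_ne L h4 ι
  haveI := Summit.HodgeConjecture.HodgeConjecture.Cruxes.HLiu418.F0P6LD1StubS1FactsOfA2P.compactSpace_lineQuotient_of_posDef L dV τ (hdef τ hτ)
  -- (R): transports `ιA`, `ιA'` (equal by the frame formula) and lines `⟨a'⟩`, `⟨a''⟩` at `λ` meeting `P`, `P'`
  obtain ⟨ιA, hιA, a', hmeet⟩ :=
    hR L ι H dV hdV hdV0 t ht g hg hsig hdef h4 𝔣 μ e₁ lam hlam hw a χ W σ hirr hsm j hj P hP hPσ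
  obtain ⟨ιA', hιA', a'', hmeet''⟩ :=
    hR L ι H dV hdV hdV0 t ht g hg hsig hdef h4 𝔣 μ e₁ lam hlam hw a χ W σ hirr hsm j hj P' hP' hP'σ
  obtain rfl : ιA' = ιA := MonoidHom.ext fun k => Subtype.ext ((hιA' k).trans (hιA k).symm)
  -- (L): the line is pinned, so `P'` meets the theta lift from `⟨a'⟩` too
  have hmeet' : MeetsThetaLiftFromLine L 2 H e₁ dV hdV hdV0 P' lam hlam a' ιA' :=
    hL L ι H dV hdV hdV0 t ht g hg hsig hdef h4 𝔣 μ e₁ lam hlam hw a χ W σ hirr hsm j hj ιA' hιA P P' hP hP' hPσ hP'σ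
      a' a'' hmeet hmeet''
  -- (I): character seams `ξ'`, `ξ''`, with the whole `ξ'`-theta space from `⟨a'⟩` inside `P`
  obtain ⟨ξ', hle, hseam⟩ := hI L ι H dV hdV hdV0 t ht g hg hsig hdef h4 μ e₁ lam hlam hw ιA' hιA P a' hmeet
  obtain ⟨ξ'', -, hseam'⟩ := hI L ι H dV hdV hdV0 t ht g hg hsig hdef h4 μ e₁ lam hlam hw ιA' hιA P' a' hmeet'
  -- (P): the character is pinned, so `P'` contains a non-zero `ξ'`-theta class from `⟨a'⟩`
  have hseam'' : CharSeam₂ L H e₁ dV hdV hdV0 P' lam hlam a' ιA' ξ' :=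
    hPin L ι H dV hdV hdV0 t ht g hg hsig hdef h4 𝔣 μ e₁ lam hlam hw a χ W σ hirr hsm j hj ιA' hιA P P' hP hP' hPσ hP'σ
      a' ξ' ξ'' hseam hseam'
  letI : MeasurableSpace (↥(UnitaryGroup.adelic (↥(maximalRealSubfield L)) L (IsCMField.complexConj L) 1
      (JW (↥(maximalRealSubfield L)) L a')) ⧸
        (UnitaryGroup.toAdelic (↥(maximalRealSubfield L)) L (IsCMField.complexConj L) 1 (JW (↥(maximalRealSubfield L)) L a')).range) :=
    borel _
  haveI := normal_range_toAdelic_JW L a'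
  obtain ⟨hρ, μW, hfin, hinv, Ψ, hθ, hmem', hne⟩ := hseam''
  have hmem : MemLp.toLp _ hθ ∈ P.space.toSubmodule := hle hρ μW hfin hinv Ψ hθ
  exact Summit.HodgeConjecture.HodgeConjecture.Cruxes.HLiu418.F0P6LD1StubS1FactsOfA2P.DiscreteAutomorphicRep.eq_of_mem_of_mem P P' _ hmem hmem' hne


end Summit.HodgeConjecture.HodgeConjecture.Cruxes.HLiu418.F0P6LD1StubS1Facts

end
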